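import Literature.NumberTheory.PAdicHodge.AinfRamifiedEtaPeriod
import HarnessLib

/-!
# `θ` of the η-period over the ramified base: `θ_dR(∫_t η) = −Σ_{i≥0} pⁱ R_p(u_{i+1})`, and transversality to `Fil¹`

Topic `Literature/NumberTheory/PAdicHodge`; the ramified twin (`W/𝒪_D`, `A_inf(𝒪)`, `θ_𝒪`) of `AinfWeierstrassEtaPeriodTheta`
(`W/ℤ`, `𝔸_inf`, `θ`); sequel of `AinfRamifiedEtaPeriod` (`∫_t η = η₀(ι_𝒪T₀) − ι_𝒪(corr t)`, `corr t = Σ_{i≥1} p^{i−1} R_p(Tᵢ) ∈ A_inf(𝒪)`).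
The main term lies in `Fil¹ = ker θ_dR`, and `θ_𝒪` is continuous and compatible with evaluation of `𝒪_D`-power series
(`θ_𝒪(R_p(Tᵢ)) = R_p(θ_𝒪Tᵢ) = R_p(uᵢ)`), so

  **`θ_dR(∫_t η) = −θ_𝒪(corr t)`,  `θ_𝒪(corr t) = lim_n Σ_{i<n} pⁱ R_p(u_{i+1})`  (`p`-adically in `𝒪_{ℂ_F}`),**

with `θ_𝒪(corr t) − Σ_{i≤n} pⁱ R_p(u_{i+1}) ∈ p^{n+1}𝒪_{ℂ_F}`; in particular `θ_𝒪(corr t) ≡ R_p(u₁) (mod p)`, whence the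
**transversality criterion** `R_p(u₁) ∉ p𝒪_{ℂ_F} ⇒ ∫_t η ∉ Fil¹ B_dR⁺` (`etaPeriod_not_mem_filOne`). The numerical input
`R_p(u₁) ∉ p𝒪_{ℂ_F}` for the good supersingular `𝒪_D`-models of the three additive cells of crux K★ is the tree's
`AinfTop.mulDefect_evalPt₁_not_mem_span_p_model` (file `AinfWeierstrassRamifiedCellsWitness`), read through
`map_mulDefect_toF` below.

* §1 `mulDefectC W u = R_p(u) ∈ 𝒪_{ℂ_F}`, `θ_𝒪(R_p(Tᵢ)) = R_p(uᵢ)`, `θ_𝒪(Sₙ) = Σ_{i<n} pⁱR_p(u_{i+1})`; `map_mulDefect_toF`;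
* §2 `θ_𝒪(corr t) − Σ_{i≤n} pⁱR_p(u_{i+1}) ∈ (p)^{n+1}`, the limit, `θ_𝒪(corr t) ≡ R_p(u₁) (mod p)`;
* §3 `θ_dR(η₀(ι_𝒪T₀)) = 0`, `θ_dR ∘ ι_𝒪 = θ_𝒪`, **`θ_dR(∫_t η) = −θ_𝒪(corr t)`**, **`R_p(u₁) ∉ (p) ⇒ θ_dR(∫_t η) ≠ 0`,
  `∫_t η ∉ Fil¹`**.

Definitions (reviewed): `mulDefectC`, `thetaCorrPartial`. No named facts, no instances, no `sorry`. Crux K★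
`stmt-BirchSwinnertonDyer-22226`, sub-unit (R1): `∫ω ∈ Fil¹`, `∫η ∉ Fil¹` make the two period maps `T_pŴ → B_dR⁺` independent.
BSD is not proved by any of this.

## References
* P. Colmez, *Périodes p-adiques des variétés abéliennes*, Math. Ann. 292 (1992), §2. [Colmez1992PeriodesAbeliennes]
* J.-M. Fontaine, *Le corps des périodes p-adiques*, Astérisque 223 (1994), Exp. II §1.2, §1.5. [FontaineAsterisque223III]
* N. M. Katz, *Crystalline cohomology, Dieudonné modules, and Jacobi sums* (1981), §5.1. [Katz1981CrystallineDieudonne]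
-/

noncomputable section

open Ideal Filter Topology Field WittVector MvPowerSeries ValuativeRel

namespace Literature.NumberTheory.PAdicHodge

open Literature.NumberTheory.GaloisRepresentations
open Literature.NumberTheory.GaloisRepresentations.IsNonarchimedeanLocalField
open Literature.NumberTheory.GaloisRepresentations.LubinTate

namespace AinfRamTop

variable {F : Type} [Field F] [ValuativeRel F] [TopologicalSpace F] [IsNonarchimedeanLocalField F] [CharZero F]
  {p : ℕ} [Fact p.Prime] [Fact (¬ IsUnit (p : integerC F))] [IsAdicComplete (Ideal.span {(p : integerC F)}) (integerC F)]
  {hp : valuation F p < 1} {D : EisensteinRoot F p hp} {hθ : Function.Surjective (fontaineTheta (integerC F) p)}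
  (W : WeierstrassCurve (EisensteinRoot.CoeffDisc D))

/-! ## §1 `θ_𝒪` of the approximants -/

variable (hθ) in
/-- **`R_p(u) ∈ 𝒪_{ℂ_F}`** for a point `u ∈ Ŵ(𝔪_{ℂ_F})`: the integral multiplication defect `R_p ∈ 𝒪_D⟦X⟧` evaluated `p`-adically
(`𝒪_{ℂ_F}` as an `𝒪_D`-algebra). [cite: Colmez1992PeriodesAbeliennes, §2] -/
def mulDefectC (u : (maxNilIdealC F).toIdeal) : CBall F :=
  (evalPt₁ (maxNilIdealC F) (mulDefect (hθ := hθ) W p) (constantCoeff_mulDefect W p) u : CBall F)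

/-- `R_n ⊗_{𝒪_D} F = Σ_{k<n} C₀([k]X, X)` along `CoeffDisc.toF : 𝒪_D → F` (the form in which the tree's η-Hasse input
`AinfTop.mulDefect_evalPt₁_not_mem_span_p_model` consumes an integral defect). [cite: Katz1981CrystallineDieudonne, §5.1] -/
theorem map_mulDefect_toF (n : ℕ) :
    PowerSeries.map (EisensteinRoot.CoeffDisc.toF D) (mulDefect (hθ := hθ) W n) =
      (W.map (EisensteinRoot.CoeffDisc.toF D)).formalQuasiPeriodMulDefect n :=
  map_mulDefect (hθ := hθ) W n

/-- **`θ_𝒪(R_p(Tᵢ)) = R_p(uᵢ)`** (`θ_𝒪` commutes with evaluation of the `𝒪_D`-series `R_p`, and `θ_𝒪(Tᵢ) = uᵢ`).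
[cite: FontaineAsterisque223III, Exp. II §1.2.2] -/
theorem theta_mulDefectAt {t : ℕ → (maxNilIdealC F).toIdeal} (htp : ∀ n, mulPC W (t (n + 1)) = t n) (i : ℕ) :
    theta D (mulDefectAt W hθ t htp i) = mulDefectC hθ W (t i) := by
  rw [mulDefectAt, mulDefectC]
  exact theta_evalPt (EisensteinRoot.theta_algebraMap_coeffDisc D) _ (constantCoeff_mulDefect W p)
    (fun _ : Unit => torsionLiftShiftPt W hθ t htp i) (fun _ : Unit => t i) fun _ => theta_torsionLiftShift W htp i

variable (hθ) in
/-- The `p`-adic partial sums `Σ_{i<n} pⁱ R_p(u_{i+1}) ∈ 𝒪_{ℂ_F}`. [cite: Colmez1992PeriodesAbeliennes, §2] -/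
def thetaCorrPartial (t : ℕ → (maxNilIdealC F).toIdeal) (n : ℕ) : CBall F :=
  ∑ i ∈ Finset.range n, (p : CBall F) ^ i * mulDefectC hθ W (t (i + 1))

/-- **`θ_𝒪(Sₙ) = Σ_{i<n} pⁱ R_p(u_{i+1})`.** [cite: Colmez1992PeriodesAbeliennes, §2] -/
theorem theta_etaCorrPartial {t : ℕ → (maxNilIdealC F).toIdeal} (htp : ∀ n, mulPC W (t (n + 1)) = t n) (n : ℕ) :
    theta D (etaCorrPartial W hθ t htp n) = thetaCorrPartial hθ W t n := by
  rw [etaCorrPartial, thetaCorrPartial, map_sum]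
  refine Finset.sum_congr rfl fun i _ => ?_
  rw [map_mul, map_pow, map_natCast, theta_mulDefectAt W (hθ := hθ) htp]

/-! ## §2 `θ_𝒪(corr t)` as a `p`-adic limit -/

/-- **`θ_𝒪(corr t) − Σ_{i≤n} pⁱ R_p(u_{i+1}) ∈ p^{n+1}𝒪_{ℂ_F}`** (`corr t − S_{n+1} ∈ 𝔦^{n+1}` and `θ_𝒪(𝔦) = (p)`).
[cite: Colmez1992PeriodesAbeliennes, §2] -/
theorem theta_etaCorr_sub_mem {t : ℕ → (maxNilIdealC F).toIdeal} (htp : ∀ n, mulPC W (t (n + 1)) = t n) (n : ℕ) :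
    theta D (etaCorr W hθ t htp) - thetaCorrPartial hθ W t (n + 1) ∈ Ideal.span {(p : CBall F)} ^ (n + 1) := by
  rw [← theta_etaCorrPartial W (hθ := hθ) htp (n + 1), ← map_sub]
  exact theta_mem_span_pow_of_mem_pow (etaCorr_sub_partial_mem W htp n)

/-- **`θ_𝒪(corr t) = lim_n Σ_{i<n} pⁱ R_p(u_{i+1})`** (`p`-adically in `𝒪_{ℂ_F}`; continuity of `θ_𝒪`). [cite: Colmez1992PeriodesAbeliennes, §2] -/
theorem tendsto_thetaCorrPartial {t : ℕ → (maxNilIdealC F).toIdeal} (htp : ∀ n, mulPC W (t (n + 1)) = t n) :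
    Tendsto (fun n => thetaCorrPartial hθ W t (n + 1)) atTop (𝓝 (theta D (etaCorr W hθ t htp))) := by
  have h := ((continuous_theta (D := D)).tendsto _).comp (tendsto_etaCorrPartial W (hθ := hθ) htp)
  exact h.congr fun n => theta_etaCorrPartial W htp (n + 1)

/-- **`θ_𝒪(corr t) ≡ R_p(u₁) (mod p)`.** [cite: Colmez1992PeriodesAbeliennes, §2] -/
theorem theta_etaCorr_sub_mulDefectC_mem {t : ℕ → (maxNilIdealC F).toIdeal} (htp : ∀ n, mulPC W (t (n + 1)) = t n) :
    theta D (etaCorr W hθ t htp) - mulDefectC hθ W (t 1) ∈ Ideal.span {(p : CBall F)} := by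
  have h := theta_etaCorr_sub_mem W (hθ := hθ) htp 0
  rwa [zero_add, pow_one, thetaCorrPartial, Finset.sum_range_one, pow_zero, one_mul, zero_add] at h

/-! ## §3 `θ_dR` of the η-period and transversality to `Fil¹` -/

/-- `θ_dR(η₀(ι_𝒪T₀)) = 0`: the main term lies in `Fil¹ = (ξ_dR) = ker θ_dR`. [cite: FontaineAsterisque223III, Exp. II §1.5.2] -/
theorem thetaBdR_etaPeriodMain {t : ℕ → (maxNilIdealC F).toIdeal} (ht0 : (t 0 : CBall F) = 0)
    (htp : ∀ n, mulPC W (t (n + 1)) = t n) :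
    thetaBdR ((BdRPlusTop.of F p).symm (etaPeriodMain W hθ t ht0 htp)) = 0 :=
  thetaBdR_eq_zero_of_mem_span (BdRPlusTop.mem_filOne_iff.1
    (evalPt₁ (BdRPlusTop.filOne F p) (etaSeries hθ W) (constantCoeff_etaSeries W) (torsionLiftFil W hθ t ht0 htp)).2)

omit [CharZero F] in
/-- `θ_dR ∘ ι_𝒪 = θ_𝒪` on `A_inf(𝒪)`. [cite: FontaineAsterisque223III, Exp. II §1.5.2] -/
theorem thetaBdR_toBdR_of_symm [CharZero F] {D : EisensteinRoot F p hp} (a : AinfRamTop D) :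
    thetaBdR ((BdRPlusTop.of F p).symm (BdRPlusTop.of F p (AinfRam.toBdR D hθ ((of D).symm a)))) =
      ((theta D a : CBall F) : CompletedAlgClosure F) := by
  rw [RingEquiv.symm_apply_apply, AinfRam.thetaBdR_toBdR, ← coe_theta ((of D).symm a), RingEquiv.apply_symm_apply]

/-- **`θ_dR(∫_t η) = −θ_𝒪(corr t)`** (`= −Σ_{i≥0} pⁱ R_p(u_{i+1})` by `tendsto_thetaCorrPartial`). [cite: Colmez1992PeriodesAbeliennes, §2] -/
theorem thetaBdR_etaPeriod {t : ℕ → (maxNilIdealC F).toIdeal} (ht0 : (t 0 : CBall F) = 0)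
    (htp : ∀ n, mulPC W (t (n + 1)) = t n) :
    thetaBdR ((BdRPlusTop.of F p).symm (etaPeriod W hθ t ht0 htp)) =
      -((theta D (etaCorr W hθ t htp) : CBall F) : CompletedAlgClosure F) := by
  rw [etaPeriod, map_sub, map_sub, thetaBdR_etaPeriodMain, thetaBdR_toBdR_of_symm, zero_sub]

/-- **Transversality criterion: `R_p(u₁) ∉ p𝒪_{ℂ_F} ⇒ θ_dR(∫_t η) ≠ 0`.** [cite: Colmez1992PeriodesAbeliennes, §2] -/
theorem thetaBdR_etaPeriod_ne_zero {t : ℕ → (maxNilIdealC F).toIdeal} (ht0 : (t 0 : CBall F) = 0)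
    (htp : ∀ n, mulPC W (t (n + 1)) = t n) (h₁ : mulDefectC hθ W (t 1) ∉ Ideal.span {(p : CBall F)}) :
    thetaBdR ((BdRPlusTop.of F p).symm (etaPeriod W hθ t ht0 htp)) ≠ 0 := by
  rw [thetaBdR_etaPeriod, neg_ne_zero]
  intro h0
  apply h₁
  have hθ0 : theta D (etaCorr W hθ t htp) = 0 := Subtype.ext (by rw [h0, ZeroMemClass.coe_zero])
  have h := theta_etaCorr_sub_mulDefectC_mem W (hθ := hθ) htp
  rwa [hθ0, zero_sub, Ideal.neg_mem_iff] at h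

/-- **`R_p(u₁) ∉ p𝒪_{ℂ_F} ⇒ ∫_t η ∉ Fil¹ B_dR⁺`**: the η-period is transverse to the Hodge filtration step containing `∫_t ω`.
[cite: Colmez1992PeriodesAbeliennes, §2] -/
theorem etaPeriod_not_mem_filOne {t : ℕ → (maxNilIdealC F).toIdeal} (ht0 : (t 0 : CBall F) = 0)
    (htp : ∀ n, mulPC W (t (n + 1)) = t n) (h₁ : mulDefectC hθ W (t 1) ∉ Ideal.span {(p : CBall F)}) :
    etaPeriod W hθ t ht0 htp ∉ (BdRPlusTop.filOne F p).toIdeal := fun h =>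
  thetaBdR_etaPeriod_ne_zero W ht0 htp h₁ (thetaBdR_eq_zero_of_mem_span (BdRPlusTop.mem_filOne_iff.1 h))

end AinfRamTop

end Literature.NumberTheory.PAdicHodge

end
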